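import Mathlib

/-!
# Stub `stub_finiteFrame` (line `einstein-bulk-transfer`, crux `AhHadamardFilling`)

On a closed smooth manifold `M` there are finitely many smooth vector fields `Y_i` such that every
continuous vector field `Z` has continuous coefficients, `Z = Σ c_i Y_i`.

Construction: a finite cover of `M` by base sets of tangent bundle trivializations, a smooth
partition of unity `ρ_k` subordinate to it, the local frames `e_{kj}` of the trivializations
(`Trivialization.localFrame`), `Y_{kj} := ρ_k • e_{kj}` and
`c_{kj} := ρ_k · z_{kj} / Σ_l ρ_l²` with `z_{kj}` the frame coefficients of `Z`.
-/

noncomputable section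

set_option linter.dupNamespace false

open scoped Manifold ContDiff Topology
open Set Function Bundle

namespace Summit.SmoothPoincare4.SmoothPoincare4.Cruxes.AhHadamardFilling.EinsteinBulkTransfer

universe u

/-- A product `ρ * f` is continuous if `ρ` is continuous, `f` is continuous on an open set `U`,
and the topological support of `ρ` lies in `U`. -/
private theorem continuous_mul_of_tsupport_subset {X : Type*} [TopologicalSpace X]
    {ρ f : X → ℝ} {U : Set X} (hU : IsOpen U) (hρ : Continuous ρ) (hsub : tsupport ρ ⊆ U)
    (hf : ContinuousOn f U) : Continuous fun x => ρ x * f x := by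
  refine continuous_of_tsupport fun x hx => ?_
  have hxU : x ∈ U := hsub (tsupport_mul_subset_left hx)
  exact hρ.continuousAt.mul (hf.continuousAt (hU.mem_nhds hxU))

section Frame

variable {E : Type*} [NormedAddCommGroup E] [NormedSpace ℝ E]
  {H : Type*} [TopologicalSpace H] {I : ModelWithCorners ℝ E H}
  {M : Type*} [TopologicalSpace M] [ChartedSpace H M] [IsManifold I ∞ M]

/-- On the base set of a compatible trivialization `e` of `TM`, the `e`-frame coefficients of a
continuous vector field `Z` are continuous. -/
private theorem continuousOn_localFrame_coeff_of_continuous [FiniteDimensional ℝ E]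
    (e : Trivialization E (π E (TangentSpace I : M → Type _))) [MemTrivializationAtlas e]
    {ι : Type*} (b : Module.Basis ι ℝ E) {Z : (x : M) → TangentSpace I x}
    (hZ : Continuous (fun x => (⟨x, Z x⟩ : TangentBundle I M))) (j : ι) :
    ContinuousOn (fun x => e.localFrame_coeff I b j x (Z x)) e.baseSet := by
  have h1 : ContinuousOn (fun x => e (⟨x, Z x⟩ : TangentBundle I M)) e.baseSet :=
    e.continuousOn.comp hZ.continuousOn fun x hx => e.mem_source.mpr hx
  have h2 : ContinuousOn (fun x => b.coord j (e (⟨x, Z x⟩ : TangentBundle I M)).2) e.baseSet :=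
    (b.coord j).continuous_of_finiteDimensional.comp_continuousOn h1.snd
  refine h2.congr fun x hx => ?_
  simp only [Module.Basis.coord_apply]
  exact e.localFrame_coeff_eq_coeff hx

/-- Pointwise resummation: with `ρ` supported in `e.baseSet`,
`Σ_j (ρ x · z_j x / S) • (ρ x • e_j x) = (ρ x ^ 2 / S) • Z x`. -/
private theorem sum_coeff_smul_frame_eq
    (e : Trivialization E (π E (TangentSpace I : M → Type _))) [MemTrivializationAtlas e]
    {ι : Type*} [Fintype ι] (b : Module.Basis ι ℝ E) (Z : (x : M) → TangentSpace I x)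
    {ρ : M → ℝ} (hρ : tsupport ρ ⊆ e.baseSet) (S : ℝ) (x : M) :
    ∑ j, (ρ x * e.localFrame_coeff I b j x (Z x) / S) • (ρ x • e.localFrame b j x) =
      (ρ x ^ 2 / S) • Z x := by
  by_cases hx : x ∈ e.baseSet
  · have hre : ∀ j, (ρ x * e.localFrame_coeff I b j x (Z x) / S) • (ρ x • e.localFrame b j x) =
        (ρ x ^ 2 / S) • (e.localFrame_coeff I b j x (Z x) • e.localFrame b j x) := by
      intro j
      rw [smul_smul, smul_smul]
      congr 1
      ring
    simp_rw [hre, ← Finset.smul_sum]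
    congr 1
    exact (e.eq_sum_localFrame_coeff_smul (I := I) (b := b) (s := Z) hx).symm
  · have h0 : ρ x = 0 := by
      by_contra h
      exact hx (hρ (subset_tsupport _ (mem_support.mpr h)))
    simp [h0]

/-- Generic version of `stub_finiteFrame`: on a compact smooth manifold there are finitely many
smooth vector fields in which every continuous vector field has continuous coefficients. -/
private theorem exists_finite_generating_frame [FiniteDimensional ℝ E]
    (I : ModelWithCorners ℝ E H) (M : Type u)
    [TopologicalSpace M] [ChartedSpace H M] [IsManifold I ∞ M] [T2Space M] [CompactSpace M] :
    ∃ (ι : Type u) (_ : Fintype ι) (Y : ι → (x : M) → TangentSpace I x),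
      (∀ i, ContMDiff I I.tangent ∞ (fun x => (⟨x, Y i x⟩ : TangentBundle I M))) ∧
      ∀ (Z : (x : M) → TangentSpace I x),
        Continuous (fun x => (⟨x, Z x⟩ : TangentBundle I M)) →
        ∃ c : ι → M → ℝ, (∀ i, Continuous (c i)) ∧ ∀ x : M, Z x = ∑ i, c i x • Y i x := by
  -- Step 1: a finite subcover of `M` by base sets of tangent bundle trivializations.
  obtain ⟨t, ht⟩ := CompactSpace.elim_nhds_subcover
    (fun p : M => (trivializationAt E (TangentSpace I) p).baseSet)
    (fun p => (trivializationAt E (TangentSpace I) p).open_baseSet.mem_nhds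
      (mem_baseSet_trivializationAt E (TangentSpace I) p))
  -- Step 2: a smooth partition of unity subordinate to this finite cover.
  obtain ⟨ρ, hρ⟩ := SmoothPartitionOfUnity.exists_isSubordinate I isClosed_univ
    (fun k : t => (trivializationAt E (TangentSpace I) (k : M)).baseSet)
    (fun k => (trivializationAt E (TangentSpace I) (k : M)).open_baseSet) (by
      intro x _
      have hx : x ∈ ⋃ p ∈ t, (trivializationAt E (TangentSpace I) p).baseSet := by
        rw [ht]; trivial
      obtain ⟨k, hk, hxk⟩ := mem_iUnion₂.mp hx
      exact mem_iUnion.mpr ⟨⟨k, hk⟩, hxk⟩)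
  -- a basis of the model fibre
  obtain ⟨b⟩ : Nonempty (Module.Basis (Fin (Module.finrank ℝ E)) ℝ E) := ⟨Module.finBasis ℝ E⟩
  -- the denominator `S x = Σ_l ρ_l(x)²`
  have hS : Continuous fun x => ∑ l, (ρ l x) ^ 2 :=
    continuous_finsetSum _ fun l _ => (ρ l).contMDiff.continuous.pow 2
  have hS' : ∀ x, ∑ l, (ρ l x) ^ 2 ≠ 0 := by
    intro x
    obtain ⟨i, hi⟩ := ρ.exists_pos_of_mem (mem_univ x)
    exact (Finset.sum_pos' (fun l _ => sq_nonneg (ρ l x))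
      ⟨i, Finset.mem_univ _, pow_pos hi 2⟩).ne'
  -- Step 3: the smooth vector fields `Y_{kj} := ρ_k • e_{kj}`.
  refine ⟨t × Fin (Module.finrank ℝ E), inferInstance,
    fun p x => ρ p.1 x • (trivializationAt E (TangentSpace I) (p.1 : M)).localFrame b p.2 x,
    ?_, ?_⟩
  · rintro ⟨k, j⟩
    exact ContMDiffOn.smul_section_of_tsupport (ρ k).contMDiff.contMDiffOn
      (trivializationAt E (TangentSpace I) (k : M)).open_baseSet (hρ k)
      ((trivializationAt E (TangentSpace I) (k : M)).contMDiffOn_localFrame_baseSet ∞ b j)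
  · intro Z hZ
    -- Step 4: the coefficients `c_{kj} := ρ_k · z_{kj} / S`.
    refine ⟨fun p x => ρ p.1 x *
      (trivializationAt E (TangentSpace I) (p.1 : M)).localFrame_coeff I b p.2 x (Z x) /
        ∑ l, (ρ l x) ^ 2, ?_, ?_⟩
    · rintro ⟨k, j⟩
      refine Continuous.div ?_ hS hS'
      exact continuous_mul_of_tsupport_subset
        (trivializationAt E (TangentSpace I) (k : M)).open_baseSet (ρ k).contMDiff.continuous
        (hρ k) (continuousOn_localFrame_coeff_of_continuous _ b hZ j)
    · intro x
      rw [Fintype.sum_prod_type]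
      simp_rw [sum_coeff_smul_frame_eq _ b Z (hρ _) _ x, ← Finset.sum_smul, ← Finset.sum_div,
        div_self (hS' x), one_smul]

end Frame

/-- **Finite generating frame.** On a closed smooth 4-manifold there are finitely many smooth
vector fields `Y_i` such that every continuous vector field `Z` has continuous coefficients
`Z = Σ c_i Y_i` (partition of unity times local frames over a finite cover by trivialization base
sets; `c_{kj} = ρ_k · z_{kj} / Σ_l ρ_l²`). -/
theorem stub_finiteFrame
    (M : Type) [TopologicalSpace M] [T2Space M] [SecondCountableTopology M]
    [ChartedSpace (EuclideanSpace ℝ (Fin 4)) M] [IsManifold (𝓡 4) ∞ M] [CompactSpace M] :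
    ∃ (m : ℕ) (Y : Fin m → (x : M) → TangentSpace (𝓡 4) x),
      (∀ i, ContMDiff (𝓡 4) (𝓡 4).tangent ∞ (fun x => (⟨x, Y i x⟩ : TangentBundle (𝓡 4) M))) ∧
      ∀ (Z : (x : M) → TangentSpace (𝓡 4) x),
        Continuous (fun x => (⟨x, Z x⟩ : TangentBundle (𝓡 4) M)) →
        ∃ c : Fin m → M → ℝ, (∀ i, Continuous (c i)) ∧ ∀ x : M, Z x = ∑ i, c i x • Y i x := by
  obtain ⟨ι, _, Y, hY, hZ⟩ := exists_finite_generating_frame (𝓡 4) M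
  refine ⟨Fintype.card ι, fun i => Y ((Fintype.equivFin ι).symm i), fun i => hY _,
    fun Z hZc => ?_⟩
  obtain ⟨c, hc, hsum⟩ := hZ Z hZc
  refine ⟨fun i => c ((Fintype.equivFin ι).symm i), fun i => hc _, fun x => ?_⟩
  rw [hsum x]
  exact (Equiv.sum_comp (Fintype.equivFin ι).symm (fun i => c i x • Y i x)).symm

end Summit.SmoothPoincare4.SmoothPoincare4.Cruxes.AhHadamardFilling.EinsteinBulkTransfer
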